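import Summits.QuantumFields.YangMills.Theorems.UnitScaleTiltProp7SymAvgTwSymDefs
import Summits.QuantumFields.YangMills.Theorems.UnitScaleTiltProp7SectET3Transport
import Summits.QuantumFields.Balaban3D.Proofs.GroupModelLieC
import Literature.MathematicalPhysics.QuantumFieldTheory.Balaban1983to89.B11Eq103H1Complex
import HarnessLib

/-!
# Route `UnitScaleTilt`, crux «MinimiserStabilityRegPr» (stmt-QuantumFields-19200, stub EX) ∕ (O″χ) B0 (stmt-QuantumFields-20520), node N06(d = 3), route (α) —
# DEFINITIONS FILE, LAYER 0 BRICK L0a: **THE HILBERT LETTERS OF [Balaban1985BackgroundPropagators] §3 AT A T³ MEMBER** — print's «natural L² scalar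
# products for functions with values in N × N hermitian matrices … X·Y = tr XY» (p. 391) on the route's `M₂(ℂ)`-valued carriers, the transporters `R(U₀(b))`,
# the identification of the route carriers `PBond (F.P K) 0 → M₂(ℂ)` with lit-balaban's weighted `L²` spaces `B11Eq103H1Complex.BondL2K ℂ 3 (periodsT3 F K) c₀ W₂`,
# THE AVERAGING OPERATOR OF RECORD `Q(U₀) := Prop7SymAvgTwSym.QTwS F n K h U₀` (OWNER RULING g26-№12 (3)) READ ON `L²` AND ITS ADJOINT `Q*(U₀)` READ BACK ON THE
# ROUTE CARRIERS, and (3.3)∕(3.8) `D_{U₀}`, `D*_{U₀}` at the member with «`D*` is the adjoint of `D`» AS A THEOREM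

Cell `ym-inputs` (desk `pub/ym-inputs`, INPUT-LIST.md v6 §4 row p01 = I-06 B0 DEFINER LEAD, layer 0 = the (L2)∕(L4)∕(L6) DEFINITION programme of WANTED №g25-1;
★★OWNER ym3-torus-plan g26 RULING №10 ADDENDUM «DEFINITIONS of `H(U₀)`∕`H₁(U₀)`∕`𝔊(U₀)` on the route's M₂(ℂ) carriers»; seat `ym-inputs-p01`, memo `pub/ym-inputs/DEFINER-MEMO-T3.md`).
YM₃ on T³ is ladder rung R3, NOT the Clay problem; nothing here is a claim about a stub, a crux, d = 4 or the mass gap.  `--supports stmt-QuantumFields-20520`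
(B0 of (O″χ) needs N06(d = 3), RULING g26-№2 (4)); count-neutral; review lane (definitions).

THE PRINT.  [Balaban1985BackgroundPropagators] p. 391: *«The adjoints are taken with respect to natural L² scalar products for functions with values in N × N
hermitian matrices. The inner product for these matrices is defined by X·Y = tr XY.»*; (3.3) p. 391 `(D^η_{U₀,μ}λ)(x) = η⁻¹(R(U₀(x,x+ηe_μ))λ(x+ηe_μ) − λ(x))`;
(3.8) p. 392 *«for derivative D acting on functions defined at points of the lattice, the adjoint operator D* is acting on functions A defined at bonds of the
lattice by the formulas (D*A)(x) = Σ_μ η⁻¹(R(U(x,x−ηe_μ))A(x−ηe_μ,x) − A(x,x+ηe_μ))»*; (3.11) p. 392 `⟨A, J⟩ = Σ_{b⊂T_η} η^d tr A(b)J(b)`; p. 393: *«the averaging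
operation used here is the operation U̿ʲ defined by the formulas (89)–(92) … (1∕η_j)Q_j(U, ηA) = Q_j(U)A + C_j(U, A) (3.14) where Q_j(U)A is a linear part»*;
(3.23) p. 394 `Δ^η_U = D^{η*}_U D^η_U`; (3.126) p. 420 `H = GQ*(QGQ*)⁻¹`.  [Balaban1985Averaging] (18)–(19) p. 21: the `L²` norm `‖X‖² = tr X*X` AND the operator norm
`|X|` on the same matrices.

WHY THIS FILE (located, DEFINER-MEMO-T3.md §1–§2).  The CONSTRUCTION of print's curved propagators from data letters exists d-generically in the tree
(`B11Eq103H1Complex`: `laplaceALatticeK c R S Δ₁ Rr Q a`, `G1LatticeK`, `KinvLatticeK`, `H1LatticeK`, `frakGLatticeK`, `RLatticeK`, and the (115)-readers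
`H1CLM`∕`frakGLatticeCLM` whose types ARE the EX binders' letter types of `Prop7StubEXOfChartPiecesTwL.stubEX_of_chartPiecesTwL` (`𝒢f`, `H₁f`)), over an ABSTRACT
Hilbert fibre `W`, transporters `R S : Bond d Pd → W →ₗ W`, and a Hilbert-level averaging `Q`.  What is missing at the T³ member `(F, n ≤ K)` of the route is
exactly the DATA: (i) the Hilbert fibre for `M₂(ℂ)` (Frobenius product) identified with the route's operator-normed `M₂(ℂ)` ([B7] (18) vs (19)); (ii) the
transporters `R(U₀(b)) = Ad(U₀(b))` with their adjoint-pair row (unitarity); (iii) the weighted `L²` transport of the route carriers (fine bonds, sites, coarse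
block fields); (iv) `Q := QTwS` on these spaces and its adjoint `Q*`; (v) (3.3)∕(3.8) at the member with `D* = D†`.  This file supplies (i)–(v); the Wilson
Hessian `Δ(U₀)` (3.10), the gauge projector `R(U₀)` (3.21), the TOTAL letters `G, H, G₁, H₁, 𝔓, 𝔊` and their algebra are the next bricks (memo §2 L0b–L0e).

WHAT IS DEFINED (member `F : T3Family`, heights `n ≤ K`, background `U₀ : GaugeField (F.P K) 0 SU(2)`; weights `c₀` (fine; print `η^d`, `η = L^{−(K−n)}`) and
`cB` (coarse block fields; print `(Lᵏη)^{d−2}·(Lᵏη)^{…} = 1` at the one-level member) kept as PARAMETERS with `Fact (0 < ·)`, fixed by the consumers):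
* §1 `W₂ := EuclideanSpace ℂ (Fin 2 × Fin 2)` and **`frobEquiv : W₂ ≃ₗ[ℂ] M₂(ℂ)`** (from `Balaban3D.Proofs.GroupModelLieC.vecE∕unvecE`), with
  `⟪frobEquiv⁻¹ X, frobEquiv⁻¹ Y⟫ = tr(Xᴴ Y)` — print's matrix product `X·Y` on the complexified fibre ([B7] (18); print's `tr` is normalised, ours is not: a
  constant factor `2`, irrelevant for adjoints);
* §2 **`adW U`, the transporter `X ↦ U X U⁻¹` on `W₂`** for a unit `U` of `M₂(ℂ)`, and at the member **`adBg F K U₀ b := adW (bgOfCfg F K U₀ b)`**,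
  **`adBgInv F K U₀ b := adW (bgOfCfg F K U₀ b)⁻¹`** (print's `R(U₀(b))`, `R(U₀(b))⁻¹` of (3.3)∕(3.8));
* §3 the `L²` transports **`toL2 F K c₀ : (PBond (F.P K) 0 → M₂(ℂ)) ≃ₗ[ℂ] BondL2K ℂ 3 (periodsT3 F K) c₀ W₂`**, **`toL2S`** (sites), **`toL2B F n cB`** (coarse block
  fields, index `PBond (F.P n) 0` kept);
* §4 **`QL2 F n K h c₀ cB U₀ := toL2B ∘ QTwS F n K h U₀ ∘ toL2⁻¹`** (print's `Q(U₀)` between the Hilbert spaces) and **`QadjPi F n K h c₀ cB U₀ := toL2⁻¹ ∘ (QL2 …)† ∘ toL2B`**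
  (print's `Q*(U₀)` READ BACK on the route carriers);
* §5 **`DL2 F n K c₀ U₀ := covDerivL2K ℂ c₀ η⁻¹ (adBg F K U₀)`** ((3.3)), **`DstarL2 F n K c₀ U₀ := covDivL2K ℂ c₀ η⁻¹ (adBgInv F K U₀)`** ((3.8)),
  **`covLapSite F n K c₀ U₀ := DstarL2 ∘ DL2`** ((3.23)).

WHAT IS PROVED (sorry-free; [folklore] linear algebra + `rfl` bookkeeping; nothing of print asserted): `inner_frobEquiv_symm` (Frobenius product); `adW_apply`,
`adW_one`, ★`inner_adW_left` (`⟪Ad(U)v, u⟫ = ⟪v, Ad(U⁻¹)u⟫` for `U⁻¹ = U*`), ★`adBg_pair` (= the hypothesis `hRS` of `B11Eq103H1Complex.adjoint_covDerivL2K` DISCHARGED at the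
member); `toL2_apply`∕`toL2_symm_apply`∕`toL2B_…`∕`toL2S_…`; `QL2_toL2` (`Q` on `L²` IS `QTwS` on the functions); ★★`QadjPi_adjunction` (print's adjunction
`cB·Σ_c tr((QA)(c)ᴴ Y(c)) = c₀·Σ_b tr(A(b)ᴴ (Q*Y)(b))` — «the adjoints are taken with respect to natural L² scalar products», p. 391, for the operator of record); ★`adjoint_DL2`
(print's (3.8) «D* is the adjoint of D» AT THE MEMBER as `LinearMap.adjoint (DL2 …) = DstarL2 …`); `DL2_apply`∕`DstarL2_apply` (the stencils (3.3)∕(3.8) verbatim on the functions);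
`covLapSite_eq` ((3.23) = `B11Eq103H1Complex.covLaplaceSiteK` at the member's data, so that `RLatticeK`∕`laplaceALatticeK`∕`G1LatticeK`∕`H1LatticeK`∕`frakGLatticeK` apply verbatim).
HONEST SCOPE.  Definitions + identities; no estimate; no positivity; `QTwS` is consumed BY NAME (its identification with the covariant symmetric tube at `U₀ ≠ 1` is brick W of
the EX plan, not here).  Not a proof of any stub; nothing continuum ∕ OS ∕ mass-gap ∕ Clay.

References: T. Bałaban, CMP **99** (1985) 389–434 [Balaban1985BackgroundPropagators] (pp. 391–394: (3.3), (3.8), (3.11), (3.14)–(3.15), (3.23); (3.126) p.420);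
CMP **98** (1985) 17–51 [Balaban1985Averaging] ((18)–(19) p.21, (89)–(92) p.31); CMP **102** (1985) 277–309 [Balaban1985Variational] ((45) p.285, (103) p.293, (110) p.294).
-/

set_option autoImplicit false

noncomputable section

open scoped InnerProductSpace ComplexConjugate Matrix.Norms.L2Operator BigOperators

namespace Summit.QuantumFields.YangMills.Theorems.Prop7SectET3HilbertLetters

open Literature.MathematicalPhysics.QuantumFieldTheory.Balaban1983to89
open Literature.MathematicalPhysics.QuantumFieldTheory.Balaban1983to89.T3ContinuumYM3Torus
open T3SectALandauChart (eta)
open B4Sect5Torus (TSite)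
open B9SectCLatticeCarrier (Bond bpos btgt)
open B9Eq311L2Pairing (WL2)
open B9Eq33CovDerivVector (covDeriv covDiv covDeriv_apply covDiv_apply)
open B11Eq103H1Complex (SiteL2K BondL2K covDerivL2K covDivL2K covLaplaceSiteK funEquiv funEquiv_apply funEquiv_symm_apply adjoint_covDerivL2K
  equiv_covDerivL2K equiv_covDivL2K)
open Summit.QuantumFields.Balaban3D.Proofs.GroupModelLieC (vecE unvecE vecE_unvecE unvecE_vecE inner_vecE vecE_apply)
open Summit.QuantumFields.YangMills.Theorems.Prop7SectET3Transport (periodsT3 siteEquiv bondEquiv cfgEquiv bgOfCfg val_bgOfCfg isUnitaryBg_bgOfCfg)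
open Summit.QuantumFields.YangMills.Theorems.Prop7SymAvgTwSym (QTwS)

/-! ## §1 The Hilbert fibre: `M₂(ℂ)` with the Frobenius product `tr(Xᴴ Y)` ([B7] (18)), identified with the route's operator-normed `M₂(ℂ)` ([B7] (19)) -/

/-- **THE HILBERT FIBRE `W₂ = ℂ^{2×2}`** — the complexified Lie algebra `𝔤ᶜ ⊆ M₂(ℂ)` carried with the `L²` (Frobenius ∕ Hilbert–Schmidt) scalar product of print
(«X·Y = tr XY», [B7] (18) `‖X‖² = tr X*X`), as Mathlib's Euclidean space so that `InnerProductSpace ℂ`, `FiniteDimensional`, `CompleteSpace` are instances.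
[cite: Balaban1985Averaging, (18) p.21] -/
abbrev W₂ : Type := EuclideanSpace ℂ (Fin 2 × Fin 2)

/-- **THE IDENTIFICATION `W₂ ≃ₗ[ℂ] M₂(ℂ)` OF THE TWO NORMINGS OF THE FIBRE** ([B7] (18) `L²` vs (19) operator norm; print uses both on the SAME matrices): the inverse
vectorisation `unvecE 2` of `Balaban3D.Proofs.GroupModelLieC`, packaged as a linear equivalence (the `φ : W ≃ₗ[ℂ] V` of `B11Eq103H1Complex` §4).
[cite: Balaban1985Averaging, (18)–(19) p.21] -/
def frobEquiv : W₂ ≃ₗ[ℂ] Matrix (Fin 2) (Fin 2) ℂ :=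
  LinearEquiv.ofLinear (unvecE 2) (vecE 2) (LinearMap.ext fun v => unvecE_vecE v) (LinearMap.ext fun x => vecE_unvecE x)

/-- `frobEquiv x = unvecE 2 x`. [folklore] -/
theorem frobEquiv_apply (x : W₂) : frobEquiv x = unvecE 2 x := rfl

/-- `frobEquiv⁻¹ X = vecE 2 X`. [folklore] -/
theorem frobEquiv_symm_apply (X : Matrix (Fin 2) (Fin 2) ℂ) : frobEquiv.symm X = vecE 2 X := rfl

/-- Coordinates: `frobEquiv⁻¹ X (i, j) = X i j`. [folklore] -/
theorem frobEquiv_symm_apply_apply (X : Matrix (Fin 2) (Fin 2) ℂ) (p : Fin 2 × Fin 2) : (frobEquiv.symm X : W₂) p = X p.1 p.2 := vecE_apply X p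

/-- **PRINT'S MATRIX PRODUCT ON THE FIBRE**: `⟪frobEquiv⁻¹ X, frobEquiv⁻¹ Y⟫_ℂ = tr(Xᴴ Y)` («X·Y = tr XY» for Hermitian `X`, complexified sesquilinearly; print's trace is
normalised `tr 1 = 1`, ours is Mathlib's — a factor `2` that no adjoint sees). [cite: Balaban1985BackgroundPropagators, p.391; Balaban1985Averaging, (18) p.21] -/
theorem inner_frobEquiv_symm (X Y : Matrix (Fin 2) (Fin 2) ℂ) : ⟪frobEquiv.symm X, frobEquiv.symm Y⟫_ℂ = Matrix.trace (X.conjTranspose * Y) := inner_vecE X Y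

/-! ## §2 The transporters `R(U₀(b)) = Ad(U₀(b))` on the fibre and their adjoint-pair row -/

/-- **THE TRANSPORTER `Ad(U) : X ↦ U X U⁻¹` ON THE HILBERT FIBRE** for a unit `U` of `M₂(ℂ)` (print's `R(U₀(b))` in (3.3), read through `frobEquiv`).
[cite: Balaban1985BackgroundPropagators, (3.3) p.391] -/
def adW (U : (Matrix (Fin 2) (Fin 2) ℂ)ˣ) : W₂ →ₗ[ℂ] W₂ :=
  frobEquiv.symm.toLinearMap ∘ₗ
    ((LinearMap.mulLeft ℂ (U : Matrix (Fin 2) (Fin 2) ℂ)) ∘ₗ (LinearMap.mulRight ℂ ((U⁻¹ : (Matrix (Fin 2) (Fin 2) ℂ)ˣ) : Matrix (Fin 2) (Fin 2) ℂ))) ∘ₗ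
      frobEquiv.toLinearMap

/-- Unfolding: `frobEquiv (adW U v) = U · frobEquiv v · U⁻¹`. [cite: Balaban1985BackgroundPropagators, (3.3) p.391] -/
theorem frobEquiv_adW (U : (Matrix (Fin 2) (Fin 2) ℂ)ˣ) (v : W₂) :
    frobEquiv (adW U v) = (U : Matrix (Fin 2) (Fin 2) ℂ) * frobEquiv v * ((U⁻¹ : (Matrix (Fin 2) (Fin 2) ℂ)ˣ) : Matrix (Fin 2) (Fin 2) ℂ) := by
  simp [adW, Matrix.mul_assoc]

/-- On matrices: `adW U (frobEquiv⁻¹ X) = frobEquiv⁻¹ (U X U⁻¹)`. [cite: Balaban1985BackgroundPropagators, (3.3) p.391] -/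
theorem adW_apply (U : (Matrix (Fin 2) (Fin 2) ℂ)ˣ) (X : Matrix (Fin 2) (Fin 2) ℂ) :
    adW U (frobEquiv.symm X) = frobEquiv.symm ((U : Matrix (Fin 2) (Fin 2) ℂ) * X * ((U⁻¹ : (Matrix (Fin 2) (Fin 2) ℂ)ˣ) : Matrix (Fin 2) (Fin 2) ℂ)) := by
  apply frobEquiv.injective
  rw [frobEquiv_adW, LinearEquiv.apply_symm_apply, LinearEquiv.apply_symm_apply]

/-- The trivial transporter: `adW 1 = id` (the flat point `U₀ = 1`). [folklore] -/
theorem adW_one : adW (1 : (Matrix (Fin 2) (Fin 2) ℂ)ˣ) = LinearMap.id := by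
  apply LinearMap.ext
  intro v
  apply frobEquiv.injective
  rw [frobEquiv_adW]
  simp

/-- **THE ADJOINT-PAIR ROW OF THE TRANSPORTERS**: for a unit `U` with `U⁻¹ = U*` (unitarity), `⟪Ad(U)v, u⟫ = ⟪v, Ad(U⁻¹)u⟫` in the Frobenius product — cyclicity of the trace.
This is the shape `hRS` under which `B11Eq103H1Complex.adjoint_covDerivL2K` gives print's «D* is the adjoint of D». [cite: Balaban1985BackgroundPropagators, (3.8) p.392] -/
theorem inner_adW_left (U : (Matrix (Fin 2) (Fin 2) ℂ)ˣ) (hU : (((U⁻¹ : (Matrix (Fin 2) (Fin 2) ℂ)ˣ) : Matrix (Fin 2) (Fin 2) ℂ)) = star (U : Matrix (Fin 2) (Fin 2) ℂ))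
    (v u : W₂) : ⟪adW U v, u⟫_ℂ = ⟪v, adW U⁻¹ u⟫_ℂ := by
  -- read both vectors as matrices
  obtain ⟨X, rfl⟩ : ∃ X, v = frobEquiv.symm X := ⟨frobEquiv v, (LinearEquiv.symm_apply_apply _ _).symm⟩
  obtain ⟨Y, rfl⟩ : ∃ Y, u = frobEquiv.symm Y := ⟨frobEquiv u, (LinearEquiv.symm_apply_apply _ _).symm⟩
  rw [adW_apply, adW_apply, inner_frobEquiv_symm, inner_frobEquiv_symm, inv_inv, hU, Matrix.star_eq_conjTranspose,
    Matrix.conjTranspose_mul, Matrix.conjTranspose_mul, Matrix.conjTranspose_conjTranspose]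
  -- `tr(U Xᴴ Uᴴ Y) = tr(Xᴴ Uᴴ Y U)`
  rw [Matrix.mul_assoc, Matrix.mul_assoc, Matrix.trace_mul_comm, ← Matrix.mul_assoc, ← Matrix.mul_assoc, ← Matrix.mul_assoc]

section Member

variable (F : T3Family) (K : ℕ)

/-- **PRINT'S TRANSPORTER `R(U₀(b))` AT THE MEMBER**: `Ad` of the background read on lit-balaban's bonds (`bgOfCfg F K U₀ : Bond 3 (periodsT3 F K) → M₂(ℂ)ˣ`) — the `R` slot of
`B11Eq103H1Complex.covDerivL2K`. [cite: Balaban1985BackgroundPropagators, (3.3) p.391] -/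
def adBg (U₀ : GaugeField (F.P K) 0 (Matrix.specialUnitaryGroup (Fin 2) ℂ)) (b : Bond 3 (periodsT3 F K)) : W₂ →ₗ[ℂ] W₂ := adW (bgOfCfg F K U₀ b)

/-- **`R(U₀(b))⁻¹ = Ad(U₀(b)⁻¹)`** — the `S` slot of `B11Eq103H1Complex.covDivL2K` ((3.8): `R(U(x, x − ηe_μ)) = R(U(x − ηe_μ, x))⁻¹` by (3.5)).
[cite: Balaban1985BackgroundPropagators, (3.5) p.391, (3.8) p.392] -/
def adBgInv (U₀ : GaugeField (F.P K) 0 (Matrix.specialUnitaryGroup (Fin 2) ℂ)) (b : Bond 3 (periodsT3 F K)) : W₂ →ₗ[ℂ] W₂ := adW (bgOfCfg F K U₀ b)⁻¹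

variable {F K}

/-- At the trivial background both transporters are the identity. [folklore] -/
theorem adBg_one (b : Bond 3 (periodsT3 F K)) : adBg F K 1 b = LinearMap.id ∧ adBgInv F K 1 b = LinearMap.id := by
  have h1 : bgOfCfg F K 1 b = 1 := by
    ext i j
    rw [val_bgOfCfg]
    rfl
  refine ⟨?_, ?_⟩
  · rw [adBg, h1, adW_one]
  · rw [adBgInv, h1, inv_one, adW_one]

/-- **THE ADJOINT-PAIR ROW AT THE MEMBER** (`hRS` of `adjoint_covDerivL2K`, DISCHARGED): `⟪R(U₀(b))v, u⟫ = ⟪v, R(U₀(b))⁻¹u⟫` — the background is unitary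
(`isUnitaryBg_bgOfCfg`). [cite: Balaban1985BackgroundPropagators, (3.8) p.392] -/
theorem adBg_pair (U₀ : GaugeField (F.P K) 0 (Matrix.specialUnitaryGroup (Fin 2) ℂ)) (b : Bond 3 (periodsT3 F K)) (v u : W₂) :
    ⟪adBg F K U₀ b v, u⟫_ℂ = ⟪v, adBgInv F K U₀ b u⟫_ℂ :=
  inner_adW_left _ (isUnitaryBg_bgOfCfg F K U₀ b) v u

end Member

/-! ## §3 The weighted `L²` transports of the route carriers (fine bonds, sites, coarse block fields) -/

section Transport

variable (F : T3Family) (K : ℕ) (c₀ : ℝ)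

/-- **THE FINE VECTOR FIELDS IN `L²`**: the route carrier `PBond (F.P K) 0 → M₂(ℂ)` identified with lit-balaban's `BondL2K ℂ 3 (periodsT3 F K) c₀ W₂` (index transport
`bondEquiv F K`, fibre `frobEquiv`; weight `c₀`, print `η^d` in (3.11)). [cite: Balaban1985BackgroundPropagators, (3.11) p.392] -/
def toL2 : (PBond (F.P K) 0 → Matrix (Fin 2) (Fin 2) ℂ) ≃ₗ[ℂ] BondL2K ℂ 3 (periodsT3 F K) c₀ W₂ :=
  (LinearEquiv.funCongrLeft ℂ (Matrix (Fin 2) (Fin 2) ℂ) (bondEquiv F K).symm).trans (funEquiv frobEquiv (fun _ : Bond 3 (periodsT3 F K) => c₀)).symm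

/-- **THE GAUGE PARAMETERS (SITE FUNCTIONS) IN `L²`**: `Site (F.P K) 0 → M₂(ℂ)` identified with `SiteL2K ℂ 3 (periodsT3 F K) c₀ W₂` (index transport `siteEquiv F K`).
[cite: Balaban1985BackgroundPropagators, p.393] -/
def toL2S : (Site (F.P K) 0 → Matrix (Fin 2) (Fin 2) ℂ) ≃ₗ[ℂ] SiteL2K ℂ 3 (periodsT3 F K) c₀ W₂ :=
  (LinearEquiv.funCongrLeft ℂ (Matrix (Fin 2) (Fin 2) ℂ) (siteEquiv F K).symm).trans (funEquiv frobEquiv (fun _ : TSite 3 (periodsT3 F K) => c₀)).symm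

variable {F K c₀}

/-- Unfolding: the `L²` vector field underlying `toL2 A` at lit-balaban's bond `p` is `frobEquiv⁻¹ (A ((bondEquiv F K)⁻¹ p))`. [cite: Balaban1985BackgroundPropagators, (3.11) p.392] -/
theorem toL2_apply (A : PBond (F.P K) 0 → Matrix (Fin 2) (Fin 2) ℂ) (p : Bond 3 (periodsT3 F K)) :
    WL2.equiv ℂ _ W₂ (toL2 F K c₀ A) p = frobEquiv.symm (A ((bondEquiv F K).symm p)) := rfl

/-- Unfolding the inverse: `toL2⁻¹ f b = frobEquiv (f (bondEquiv F K b))`. [cite: Balaban1985BackgroundPropagators, (3.11) p.392] -/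
theorem toL2_symm_apply (f : BondL2K ℂ 3 (periodsT3 F K) c₀ W₂) (b : PBond (F.P K) 0) :
    (toL2 F K c₀).symm f b = frobEquiv (WL2.equiv ℂ _ W₂ f (bondEquiv F K b)) := by
  simp [toL2, funEquiv, LinearEquiv.funCongrLeft, LinearMap.funLeft]

/-- Unfolding: `toL2S λ` at lit-balaban's site `y` is `frobEquiv⁻¹ (λ ((siteEquiv F K)⁻¹ y))`. [cite: Balaban1985BackgroundPropagators, p.393] -/
theorem toL2S_apply (l : Site (F.P K) 0 → Matrix (Fin 2) (Fin 2) ℂ) (y : TSite 3 (periodsT3 F K)) :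
    WL2.equiv ℂ _ W₂ (toL2S F K c₀ l) y = frobEquiv.symm (l ((siteEquiv F K).symm y)) := rfl

/-- Unfolding the inverse: `toL2S⁻¹ g x = frobEquiv (g (siteEquiv F K x))`. [cite: Balaban1985BackgroundPropagators, p.393] -/
theorem toL2S_symm_apply (g : SiteL2K ℂ 3 (periodsT3 F K) c₀ W₂) (x : Site (F.P K) 0) :
    (toL2S F K c₀).symm g x = frobEquiv (WL2.equiv ℂ _ W₂ g (siteEquiv F K x)) := by
  simp [toL2S, funEquiv, LinearEquiv.funCongrLeft, LinearMap.funLeft]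

/-- **THE `L²` SCALAR PRODUCT OF TWO FINE VECTOR FIELDS IS PRINT'S (3.11)**: `⟪toL2 A, toL2 B⟫ = c₀ · Σ_b tr(A(b)ᴴ B(b))` (sum over the route's bonds).
[cite: Balaban1985BackgroundPropagators, (3.11) p.392] -/
theorem inner_toL2 [Fact (0 < c₀)] (A B : PBond (F.P K) 0 → Matrix (Fin 2) (Fin 2) ℂ) :
    ⟪toL2 F K c₀ A, toL2 F K c₀ B⟫_ℂ = (c₀ : ℂ) * ∑ b : PBond (F.P K) 0, Matrix.trace ((A b).conjTranspose * B b) := by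
  rw [WL2.inner_def, ← Finset.mul_sum]
  congr 1
  rw [← (bondEquiv F K).sum_comp]
  refine Finset.sum_congr rfl fun b _ => ?_
  rw [toL2_apply, toL2_apply, inner_frobEquiv_symm, Equiv.symm_apply_apply]

variable (F) (n : ℕ) (cB : ℝ)

/-- **THE COARSE BLOCK FIELDS IN `L²`**: the route carrier `PBond (F.P n) 0 → M₂(ℂ)` of the constraint data `B` (the `𝔅 = Λ_k` functions) with weight `cB` (print:
`(Lᵏη)^{d−2}`-normalised block pairing of (3.16), `= 1` at the one-level member), the block index KEPT. [cite: Balaban1985BackgroundPropagators, (3.16) p.393] -/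
def toL2B : (PBond (F.P n) 0 → Matrix (Fin 2) (Fin 2) ℂ) ≃ₗ[ℂ] WL2 ℂ (fun _ : PBond (F.P n) 0 => cB) W₂ :=
  (funEquiv frobEquiv (fun _ : PBond (F.P n) 0 => cB)).symm

variable {F n cB}

/-- Unfolding: `toL2B B c = frobEquiv⁻¹ (B c)`. [cite: Balaban1985BackgroundPropagators, (3.16) p.393] -/
theorem toL2B_apply (B : PBond (F.P n) 0 → Matrix (Fin 2) (Fin 2) ℂ) (c : PBond (F.P n) 0) : WL2.equiv ℂ _ W₂ (toL2B F n cB B) c = frobEquiv.symm (B c) := rfl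

/-- Unfolding the inverse: `toL2B⁻¹ g c = frobEquiv (g c)`. [cite: Balaban1985BackgroundPropagators, (3.16) p.393] -/
theorem toL2B_symm_apply (g : WL2 ℂ (fun _ : PBond (F.P n) 0 => cB) W₂) (c : PBond (F.P n) 0) : (toL2B F n cB).symm g c = frobEquiv (WL2.equiv ℂ _ W₂ g c) := rfl

/-- The block pairing: `⟪toL2B B, toL2B B′⟫ = cB · Σ_c tr(B(c)ᴴ B′(c))`. [cite: Balaban1985BackgroundPropagators, (3.16) p.393] -/
theorem inner_toL2B [Fact (0 < cB)] (B B' : PBond (F.P n) 0 → Matrix (Fin 2) (Fin 2) ℂ) :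
    ⟪toL2B F n cB B, toL2B F n cB B'⟫_ℂ = (cB : ℂ) * ∑ c : PBond (F.P n) 0, Matrix.trace ((B c).conjTranspose * B' c) := by
  rw [WL2.inner_def, ← Finset.mul_sum]
  exact congrArg _ (Finset.sum_congr rfl fun c _ => by rw [toL2B_apply, toL2B_apply, inner_frobEquiv_symm])

end Transport

/-! ## §4 The averaging operator of record `Q(U₀) := QTwS` on `L²` and its adjoint `Q*(U₀)` read back on the route carriers -/

section Averaging

variable (F : T3Family) (n K : ℕ) (h : n ≤ K) (c₀ cB : ℝ)

/-- **PRINT'S `Q(U₀)` BETWEEN THE HILBERT SPACES** — «Q_j(U)A is a linear part of the function (3.13)» — := the averaging operator OF RECORD `Prop7SymAvgTwSym.QTwS F n K h U₀`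
(the symmetric covariant tube, OWNER RULING g26-№12 (3)) conjugated by the `L²` transports: the `Q` slot of `B11Eq103H1Complex.laplaceALatticeK`∕`H1LatticeK`∕`frakGLatticeK`.
[cite: Balaban1985BackgroundPropagators, (3.14)–(3.15) p.393] -/
def QL2 (U₀ : GaugeField (F.P K) 0 (Matrix.specialUnitaryGroup (Fin 2) ℂ)) :
    BondL2K ℂ 3 (periodsT3 F K) c₀ W₂ →ₗ[ℂ] WL2 ℂ (fun _ : PBond (F.P n) 0 => cB) W₂ :=
  (toL2B F n cB).toLinearMap ∘ₗ (QTwS F n K h U₀).toLinearMap ∘ₗ (toL2 F K c₀).symm.toLinearMap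

variable [Fact (0 < c₀)] [Fact (0 < cB)]

/-- **PRINT'S ADJOINT `Q*(U₀)` READ BACK ON THE ROUTE CARRIERS**: `toL2⁻¹ ∘ (QL2 U₀)† ∘ toL2B` — the `Q*` of (3.16), (3.126) `H = GQ*(QGQ*)⁻¹`, (3.129), for the operator of record,
«taken with respect to natural L² scalar products» (p. 391). [cite: Balaban1985BackgroundPropagators, p.391, (3.126) p.420] -/
def QadjPi (U₀ : GaugeField (F.P K) 0 (Matrix.specialUnitaryGroup (Fin 2) ℂ)) :
    (PBond (F.P n) 0 → Matrix (Fin 2) (Fin 2) ℂ) →ₗ[ℂ] (PBond (F.P K) 0 → Matrix (Fin 2) (Fin 2) ℂ) :=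
  (toL2 F K c₀).symm.toLinearMap ∘ₗ LinearMap.adjoint (QL2 F n K h c₀ cB U₀) ∘ₗ (toL2B F n cB).toLinearMap

variable {F n K h c₀ cB}

omit [Fact (0 < c₀)] [Fact (0 < cB)] in
/-- **`Q` ON `L²` IS `QTwS` ON THE FUNCTIONS**: `QL2 U₀ (toL2 A) = toL2B (QTwS U₀ A)`. [cite: Balaban1985BackgroundPropagators, (3.14) p.393] -/
theorem QL2_toL2 (U₀ : GaugeField (F.P K) 0 (Matrix.specialUnitaryGroup (Fin 2) ℂ)) (A : PBond (F.P K) 0 → Matrix (Fin 2) (Fin 2) ℂ) :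
    QL2 F n K h c₀ cB U₀ (toL2 F K c₀ A) = toL2B F n cB (QTwS F n K h U₀ A) := by
  simp [QL2]

/-- `Q*` read back is the Hilbert adjoint conjugated by the transports: `toL2 (QadjPi U₀ Y) = (QL2 U₀)† (toL2B Y)`. [cite: Balaban1985BackgroundPropagators, p.391] -/
theorem toL2_QadjPi (U₀ : GaugeField (F.P K) 0 (Matrix.specialUnitaryGroup (Fin 2) ℂ)) (Y : PBond (F.P n) 0 → Matrix (Fin 2) (Fin 2) ℂ) :
    toL2 F K c₀ (QadjPi F n K h c₀ cB U₀ Y) = LinearMap.adjoint (QL2 F n K h c₀ cB U₀) (toL2B F n cB Y) := by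
  simp [QadjPi]

/-- **PRINT'S ADJUNCTION FOR THE OPERATOR OF RECORD, ON THE ROUTE CARRIERS**: `cB·Σ_c tr((Q(U₀)A)(c)ᴴ Y(c)) = c₀·Σ_b tr(A(b)ᴴ (Q*(U₀)Y)(b))` — the defining property of `Q*(U₀)`
w.r.t. the natural `L²` scalar products (3.11)∕(3.16). [cite: Balaban1985BackgroundPropagators, p.391, (3.11) p.392, (3.16) p.393] -/
theorem QadjPi_adjunction (U₀ : GaugeField (F.P K) 0 (Matrix.specialUnitaryGroup (Fin 2) ℂ)) (A : PBond (F.P K) 0 → Matrix (Fin 2) (Fin 2) ℂ)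
    (Y : PBond (F.P n) 0 → Matrix (Fin 2) (Fin 2) ℂ) :
    (cB : ℂ) * ∑ c : PBond (F.P n) 0, Matrix.trace ((QTwS F n K h U₀ A c).conjTranspose * Y c) =
      (c₀ : ℂ) * ∑ b : PBond (F.P K) 0, Matrix.trace ((A b).conjTranspose * QadjPi F n K h c₀ cB U₀ Y b) := by
  rw [← inner_toL2B (cB := cB), ← inner_toL2 (c₀ := c₀), ← QL2_toL2, toL2_QadjPi, LinearMap.adjoint_inner_right]

end Averaging

/-! ## §5 (3.3)∕(3.8)∕(3.23) at the member: `D_{U₀}`, `D*_{U₀}`, `Δ^η_{U₀}` on the `L²` spaces, with `D* = D†` as a theorem -/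

section Derivatives

variable (F : T3Family) (n K : ℕ) (c₀ : ℝ) [Fact (0 < c₀)]

/-- **(3.3) `D_{U₀}` AT THE MEMBER**: `covDerivL2K ℂ c₀ η⁻¹ (adBg F K U₀)` — gauge parameters to vector fields, spacing `η = eta F n K = L^{−(K−n)}`.
[cite: Balaban1985BackgroundPropagators, (3.3) p.391] -/
def DL2 (U₀ : GaugeField (F.P K) 0 (Matrix.specialUnitaryGroup (Fin 2) ℂ)) : SiteL2K ℂ 3 (periodsT3 F K) c₀ W₂ →ₗ[ℂ] BondL2K ℂ 3 (periodsT3 F K) c₀ W₂ :=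
  covDerivL2K ℂ c₀ (((eta F n K : ℝ) : ℂ)⁻¹) (adBg F K U₀)

/-- **(3.8) `D*_{U₀}` AT THE MEMBER**: `covDivL2K ℂ c₀ η⁻¹ (adBgInv F K U₀)` — vector fields to gauge parameters. [cite: Balaban1985BackgroundPropagators, (3.8) p.392] -/
def DstarL2 (U₀ : GaugeField (F.P K) 0 (Matrix.specialUnitaryGroup (Fin 2) ℂ)) : BondL2K ℂ 3 (periodsT3 F K) c₀ W₂ →ₗ[ℂ] SiteL2K ℂ 3 (periodsT3 F K) c₀ W₂ :=
  covDivL2K ℂ c₀ (((eta F n K : ℝ) : ℂ)⁻¹) (adBgInv F K U₀)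

/-- **(3.23) THE COVARIANT LAPLACE OPERATOR `Δ^η_{U₀} = D*_{U₀}D_{U₀}` ON THE GAUGE PARAMETERS AT THE MEMBER.** [cite: Balaban1985BackgroundPropagators, (3.23) p.394] -/
def covLapSite (U₀ : GaugeField (F.P K) 0 (Matrix.specialUnitaryGroup (Fin 2) ℂ)) : SiteL2K ℂ 3 (periodsT3 F K) c₀ W₂ →ₗ[ℂ] SiteL2K ℂ 3 (periodsT3 F K) c₀ W₂ :=
  DstarL2 F n K c₀ U₀ ∘ₗ DL2 F n K c₀ U₀

variable {F n K c₀}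

/-- `covLapSite` IS `B11Eq103H1Complex.covLaplaceSiteK` at the member's data (so `RLatticeK`∕`laplaceALatticeK` of that file apply verbatim), by `rfl`.
[cite: Balaban1985BackgroundPropagators, (3.23) p.394] -/
theorem covLapSite_eq (U₀ : GaugeField (F.P K) 0 (Matrix.specialUnitaryGroup (Fin 2) ℂ)) :
    covLapSite F n K c₀ U₀ = covLaplaceSiteK (((eta F n K : ℝ) : ℂ)⁻¹) (adBg F K U₀) (adBgInv F K U₀) := rfl

/-- **PRINT'S «D* IS THE ADJOINT OF D» (p. 392) AT THE MEMBER, AS A THEOREM**: `LinearMap.adjoint (DL2 U₀) = DstarL2 U₀` on the weighted `L²` spaces — `adjoint_covDerivL2K` with the real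
spacing factor `η⁻¹` and the adjoint-pair row `adBg_pair` of the unitary background. [cite: Balaban1985BackgroundPropagators, (3.8) p.392] -/
theorem adjoint_DL2 (U₀ : GaugeField (F.P K) 0 (Matrix.specialUnitaryGroup (Fin 2) ℂ)) : LinearMap.adjoint (DL2 F n K c₀ U₀) = DstarL2 F n K c₀ U₀ :=
  adjoint_covDerivL2K (𝕜 := ℂ) _ (by rw [← Complex.ofReal_inv, Complex.conj_ofReal]) _ _ (adBg_pair U₀)

/-- `⟨λ, Δ^η_{U₀}λ⟩ = ‖D_{U₀}λ‖²`: the covariant Laplace operator is the positive operator `D†D`. [cite: Balaban1985BackgroundPropagators, (3.23) p.394] -/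
theorem inner_covLapSite (U₀ : GaugeField (F.P K) 0 (Matrix.specialUnitaryGroup (Fin 2) ℂ)) (l : SiteL2K ℂ 3 (periodsT3 F K) c₀ W₂) :
    ⟪l, covLapSite F n K c₀ U₀ l⟫_ℂ = ((‖DL2 F n K c₀ U₀ l‖ : ℝ) : ℂ) ^ 2 := by
  rw [covLapSite, LinearMap.comp_apply, ← adjoint_DL2, LinearMap.adjoint_inner_right]
  exact inner_self_eq_norm_sq_to_K _

/-- **THE STENCIL (3.3) VERBATIM ON THE ROUTE'S FUNCTIONS**: reading `D_{U₀}λ` back on the route carriers,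
`(Dλ)(b) = η⁻¹·(U₀(b)·λ(b₊)·U₀(b)⁻¹ − λ(b₋))` for the site function `λ`. [cite: Balaban1985BackgroundPropagators, (3.3) p.391] -/
theorem DL2_apply (U₀ : GaugeField (F.P K) 0 (Matrix.specialUnitaryGroup (Fin 2) ℂ)) (l : Site (F.P K) 0 → Matrix (Fin 2) (Fin 2) ℂ) (b : PBond (F.P K) 0) :
    (toL2 F K c₀).symm (DL2 F n K c₀ U₀ (toL2S F K c₀ l)) b =
      (((eta F n K : ℝ) : ℂ)⁻¹) • (((U₀ b : Matrix.specialUnitaryGroup (Fin 2) ℂ) : Matrix (Fin 2) (Fin 2) ℂ) * l b.tgt *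
        (((bgOfCfg F K U₀ (bondEquiv F K b))⁻¹ : (Matrix (Fin 2) (Fin 2) ℂ)ˣ) : Matrix (Fin 2) (Fin 2) ℂ) - l b.src) := by
  rw [toL2_symm_apply, DL2, equiv_covDerivL2K, covDeriv_apply, map_smul, map_sub, toL2S_apply, toL2S_apply, adBg, adW_apply, LinearEquiv.apply_symm_apply,
    LinearEquiv.apply_symm_apply, val_bgOfCfg, Equiv.symm_apply_apply, Prop7SectET3Transport.btgt_bondEquiv, Equiv.symm_apply_apply,
    Prop7SectET3Transport.bpos_bondEquiv, Equiv.symm_apply_apply]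

/-- **THE STENCIL (3.8) VERBATIM ON THE ROUTE'S FUNCTIONS** (lit-balaban's indices: `unshift μ y = y − e_μ`): reading `D*_{U₀}A` back on the route carriers,
`(D*A)(x) = η⁻¹·Σ_μ (U₀(x−e_μ,x)⁻¹·A(x−e_μ,x)·U₀(x−e_μ,x) − A(x,x+e_μ))` — print's `R(U(x,x−ηe_μ))A(x−ηe_μ,x) − A(x,x+ηe_μ)` with `R(U(x,x−ηe_μ)) = Ad(U(x−ηe_μ,x))⁻¹` by (3.5).
[cite: Balaban1985BackgroundPropagators, (3.8) p.392, (3.5) p.391] -/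
theorem DstarL2_apply (U₀ : GaugeField (F.P K) 0 (Matrix.specialUnitaryGroup (Fin 2) ℂ)) (A : PBond (F.P K) 0 → Matrix (Fin 2) (Fin 2) ℂ) (x : Site (F.P K) 0) :
    (toL2S F K c₀).symm (DstarL2 F n K c₀ U₀ (toL2 F K c₀ A)) x =
      (((eta F n K : ℝ) : ℂ)⁻¹) • ∑ μ : Fin 3,
        ((((bgOfCfg F K U₀ (B9SectCLatticeCarrier.unshift μ (siteEquiv F K x), μ))⁻¹ : (Matrix (Fin 2) (Fin 2) ℂ)ˣ) : Matrix (Fin 2) (Fin 2) ℂ) *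
            A ((bondEquiv F K).symm (B9SectCLatticeCarrier.unshift μ (siteEquiv F K x), μ)) *
            ((bgOfCfg F K U₀ (B9SectCLatticeCarrier.unshift μ (siteEquiv F K x), μ) : (Matrix (Fin 2) (Fin 2) ℂ)ˣ) : Matrix (Fin 2) (Fin 2) ℂ) -
          A ((bondEquiv F K).symm (siteEquiv F K x, μ))) := by
  rw [toL2S_symm_apply, DstarL2, equiv_covDivL2K, covDiv_apply, map_smul, map_sum]
  refine congrArg _ (Finset.sum_congr rfl fun μ _ => ?_)
  rw [map_sub, toL2_apply, toL2_apply, adBgInv, adW_apply, inv_inv, LinearEquiv.apply_symm_apply, LinearEquiv.apply_symm_apply]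

end Derivatives

end Summit.QuantumFields.YangMills.Theorems.Prop7SectET3HilbertLetters

end
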